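import Mathlib
import Literature.Computability.AlgebraicComplexity.GroupTheoreticMatMul
import Summits.MatrixMultiplication.MatrixMultiplication.Theorems.ThinPackings.Negative.TriageRuledGraphPatternedArc

/-!
# drefute evidence — `stub_gradedFrames` is TRUE (sorry-free proof of the registered signature)

Crux `ThinPackings` (stmt-MatrixMultiplication-10595), line `label-weighted-stpp-debordering`,
registered stub `stub_gradedFrames` (skeleton sha ca8354006f96…): for an orthogonal frame family on
graded spheres with admissible slopes, `IsLabelWeightedSTPP A B C (−d) (−d) ↔ ResidualClauses A B C d`.
Proof = the line card's hand argument (Pythagoras; four label patterns), kernel-checked.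
Refuter seat refuter-drefute-stmt-MatrixMultiplication-10595-0, 2026-08-16.  Positive lemma: NOT landed by
the refuter (prover-only lane); attached as candidate proof / evidence for the lead.
-/

set_option linter.dupNamespace false

namespace Summit.MatrixMultiplication.MatrixMultiplication.Cruxes.ThinPackings.Drefute

open Matrix
open Summit.MatrixMultiplication.MatrixMultiplication.Theorems.ThinPackings.Negative.Triage2
  (IsLabelWeightedSTPP)

/-! ## Norm-square helpers over `ℤ^D` -/

section Helpers

variable {D : ℕ}

theorem dp_self_nonneg (v : Fin D → ℤ) : 0 ≤ v ⬝ᵥ v :=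
  Finset.sum_nonneg fun i _ => mul_self_nonneg (v i)

theorem one_le_dp_self_of_ne_zero {v : Fin D → ℤ} (hv : v ≠ 0) : 1 ≤ v ⬝ᵥ v := by
  have h0 : 0 ≤ v ⬝ᵥ v := dp_self_nonneg v
  have hne : v ⬝ᵥ v ≠ 0 := fun h => hv (dotProduct_self_eq_zero.1 h)
  omega

theorem normsq_add (x y : Fin D → ℤ) :
    (x + y) ⬝ᵥ (x + y) = x ⬝ᵥ x + y ⬝ᵥ y + 2 * (x ⬝ᵥ y) := by
  simp only [add_dotProduct, dotProduct_add, dotProduct_comm y x]; ring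

theorem normsq_sub (x y : Fin D → ℤ) :
    (x - y) ⬝ᵥ (x - y) = x ⬝ᵥ x + y ⬝ᵥ y - 2 * (x ⬝ᵥ y) := by
  simp only [sub_dotProduct, dotProduct_sub, dotProduct_comm y x]; ring

theorem normsq_add_three (x y z : Fin D → ℤ) :
    (x + y + z) ⬝ᵥ (x + y + z) =
      x ⬝ᵥ x + y ⬝ᵥ y + z ⬝ᵥ z + 2 * (x ⬝ᵥ y) + 2 * (x ⬝ᵥ z) + 2 * (y ⬝ᵥ z) := by
  simp only [add_dotProduct, dotProduct_add, dotProduct_comm y x, dotProduct_comm z x,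
    dotProduct_comm z y]
  ring

/-- dot product of two differences, expanded. -/
theorem sub_dp_sub (p q r w : Fin D → ℤ) :
    (p - q) ⬝ᵥ (r - w) = p ⬝ᵥ r - p ⬝ᵥ w - q ⬝ᵥ r + q ⬝ᵥ w := by
  simp only [sub_dotProduct, dotProduct_sub]; ring

/-- Three pairwise-orthogonal integer vectors summing to zero all vanish. -/
theorem eq_zero_of_orth_sum_zero {x y z : Fin D → ℤ} (hxy : x ⬝ᵥ y = 0) (hxz : x ⬝ᵥ z = 0)
    (hyz : y ⬝ᵥ z = 0) (h : x + y + z = 0) : x = 0 ∧ y = 0 ∧ z = 0 := by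
  have hsum : x ⬝ᵥ x + y ⬝ᵥ y + z ⬝ᵥ z = 0 := by
    have := normsq_add_three x y z
    rw [h, hxy, hxz, hyz] at this
    simp at this
    linarith
  have hx := dp_self_nonneg x
  have hy := dp_self_nonneg y
  have hz := dp_self_nonneg z
  refine ⟨dotProduct_self_eq_zero.1 (by omega), dotProduct_self_eq_zero.1 (by omega),
    dotProduct_self_eq_zero.1 (by omega)⟩

end Helpers

/-! ## The registered signature, verbatim -/

/-- Registered signature of `stub_gradedFrames` (= `GradedFramesWeighted` of the skeleton, with the
lead's vocabulary: `⬝ᵥ`, inlined `AdmissibleSlopes` / `IsFrameFamily` / `OnGradedSpheres` /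
`ResidualClauses`). -/
def GradedFramesWeightedReg : Prop :=
  ∀ (D L : ℕ) (A B C : Fin L → Finset (Fin D → ℤ)) (d : Fin L → ℤ) (xA xB xC α β γ : ℤ), (0 ≤ α ∧ 0 ≤ γ ∧ 1 ≤ α + γ ∧ α < β ∧ γ < β) → ((∀ i, ∀ x ∈ A i, ∀ y ∈ B i, x ⬝ᵥ y = 0) ∧ (∀ i, ∀ x ∈ A i, ∀ z ∈ C i, x ⬝ᵥ z = 0) ∧ (∀ i, ∀ y ∈ B i, ∀ z ∈ C i, y ⬝ᵥ z = 0)) → ((∀ i, ∀ x ∈ A i, x ⬝ᵥ x = xA + α * d i) ∧ (∀ i, ∀ y ∈ B i, y ⬝ᵥ y = xB - β * d i) ∧ (∀ i, ∀ z ∈ C i, z ⬝ᵥ z = xC + γ * d i)) → (IsLabelWeightedSTPP A B C (fun i => -d i) (fun i => -d i) ↔ ((∀ i k, ∀ a ∈ A i, ∀ c ∈ C i, ∀ a' ∈ A k, ∀ c' ∈ C k, c - a = c' - a' → i = k ∧ a = a' ∧ c = c') ∧ (∀ i k, ∀ a ∈ A i, ∀ b ∈ B i, ∀ a' ∈ A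 k, ∀ b' ∈ B k, b - a = b' - a' → i = k ∧ a = a' ∧ b = b') ∧ (∀ i k, ∀ b ∈ B i, ∀ c ∈ C i, ∀ b' ∈ B k, ∀ c' ∈ C k, b - c = b' - c' → i = k ∧ b = b' ∧ c = c') ∧ (∀ i j k : Fin L, i ≠ j → j ≠ k → i ≠ k → 2 * d k ≤ d i + d j → ∀ s ∈ A k, ∀ s' ∈ A i, ∀ t ∈ B i, ∀ t' ∈ B j, ∀ u ∈ C j, ∀ u' ∈ C k, (s' - s) + (t' - t) + (u' - u) ≠ 0)))

/-- Swapping the sides of a difference equation in an additive group. -/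
theorem sub_eq_sub_swap {G : Type*} [AddCommGroup G] {a b a' b' : G} (h : a - b = a' - b') :
    b - a = b' - a' := by
  rw [← neg_sub a b, ← neg_sub a' b', h]

/-- **`stub_gradedFrames` holds.** -/
theorem gradedFramesWeighted : GradedFramesWeightedReg := by
  intro D L A B C d xA xB xC α β γ hsl hfr hsph
  obtain ⟨hα0, hγ0, hαγ, hαβ, hγβ⟩ := hsl
  obtain ⟨hAB, hAC, hBC⟩ := hfr
  obtain ⟨hA, hB, hC⟩ := hsph
  constructor
  · -- `→`: read off clauses (1)–(3) and (5)
    rintro ⟨h1, h2, h3, -, h5⟩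
    refine ⟨?_, ?_, ?_, ?_⟩
    · intro i k a ha c hc a' ha' c' hc' he
      obtain ⟨hik, hcc, haa⟩ := h3 i k c hc a ha c' hc' a' ha' he
      exact ⟨hik, haa, hcc⟩
    · intro i k a ha b hb a' ha' b' hb' he
      obtain ⟨hik, haa, hbb⟩ := h1 i k a ha b hb a' ha' b' hb' (sub_eq_sub_swap he)
      exact ⟨hik, haa, hbb⟩
    · intro i k b hb c hc b' hb' c' hc' he
      exact h2 i k b hb c hc b' hb' c' hc' he
    · intro i j k hij hjk hik hconv s hs s' hs' t ht t' ht' u hu u' hu' h0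
      have hne : ¬ (i = j ∧ j = k) := fun h => hij h.1
      have hw := h5 i j k hne s hs s' hs' t ht t' ht' u hu u' hu' h0
      simp only [sub_neg_eq_add] at hw
      omega
  · -- `←`: packings + non-convex distinct clause + geometry give the weighted family
    rintro ⟨r1, r2, r3, r4⟩
    refine ⟨?_, ?_, ?_, ?_, ?_⟩
    · -- (1) A–B packing from (R2)
      intro i k s hs t ht s' hs' t' ht' he
      obtain ⟨hik, hss, htt⟩ := r2 i k s hs t ht s' hs' t' ht' (sub_eq_sub_swap he)
      exact ⟨hik, hss, htt⟩
    · -- (2) B–C packing = (R3)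
      intro j k t ht u hu t' ht' u' hu' he
      exact r3 j k t ht u hu t' ht' u' hu' he
    · -- (3) C–A packing from (R1)
      intro i k u hu s hs u' hu' s' hs' he
      obtain ⟨hik, hss, huu⟩ := r1 i k s hs u hu s' hs' u' hu' he
      exact ⟨hik, huu, hss⟩
    · -- (4) TPP of each block, by Pythagoras
      intro i s hs s' hs' t ht t' ht' u hu u' hu' h0
      have hxy : (s' - s) ⬝ᵥ (t' - t) = 0 := by
        rw [sub_dp_sub, hAB i s' hs' t' ht', hAB i s' hs' t ht, hAB i s hs t' ht', hAB i s hs t ht]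
        ring
      have hxz : (s' - s) ⬝ᵥ (u' - u) = 0 := by
        rw [sub_dp_sub, hAC i s' hs' u' hu', hAC i s' hs' u hu, hAC i s hs u' hu', hAC i s hs u hu]
        ring
      have hyz : (t' - t) ⬝ᵥ (u' - u) = 0 := by
        rw [sub_dp_sub, hBC i t' ht' u' hu', hBC i t' ht' u hu, hBC i t ht u' hu', hBC i t ht u hu]
        ring
      obtain ⟨hx, hy, hz⟩ := eq_zero_of_orth_sum_zero hxy hxz hyz h0
      exact ⟨(sub_eq_zero.1 hx).symm, (sub_eq_zero.1 hy).symm, (sub_eq_zero.1 hz).symm⟩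
    · -- (5) cross relations: four label patterns
      intro i j k hne s hs s' hs' t ht t' ht' u hu u' hu' h0
      simp only [sub_neg_eq_add]
      by_cases hij : i = j
      · subst hij
        -- pattern (i, i, k), i ≠ k :  (α+γ)(d k − d i) = ‖t' − t‖²
        have hik : i ≠ k := fun h => hne ⟨rfl, h⟩
        have hdec : s - u' = (s' - u) + (t' - t) := by
          have key : (s' - u) + (t' - t) - (s - u') = 0 := by rw [← h0]; abel
          exact (sub_eq_zero.1 key).symm
        have horth : (s' - u) ⬝ᵥ (t' - t) = 0 := by
          rw [sub_dp_sub, hAB i s' hs' t' ht', hAB i s' hs' t ht, dotProduct_comm u t',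
            hBC i t' ht' u hu, dotProduct_comm u t, hBC i t ht u hu]
          ring
        have hL : (s - u') ⬝ᵥ (s - u') = (xA + α * d k) + (xC + γ * d k) := by
          rw [normsq_sub, hA k s hs, hC k u' hu', hAC k s hs u' hu']; ring
        have hR : ((s' - u) + (t' - t)) ⬝ᵥ ((s' - u) + (t' - t)) =
            (xA + α * d i) + (xC + γ * d i) + (t' - t) ⬝ᵥ (t' - t) := by
          rw [normsq_add, horth, normsq_sub s' u, hA i s' hs', hC i u hu, hAC i s' hs' u hu]; ring
        have heq : (α + γ) * (d k - d i) = (t' - t) ⬝ᵥ (t' - t) := by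
          have := hL; rw [hdec, hR] at this; linarith
        -- `t ≠ t'`, else a tile collision between blocks i and k
        have htt : t' - t ≠ 0 := by
          intro hz
          have htt' : t' = t := sub_eq_zero.1 hz
          -- relation becomes u − s' = u' − s with u ∈ C i, s' ∈ A i, u' ∈ C k, s ∈ A k
          have hrel : u - s' = u' - s := by
            have key : (u' - s) - (u - s') = 0 := by
              rw [← h0, htt', sub_self, add_zero]; abel
            exact (sub_eq_zero.1 key).symm
          exact hik (r1 i k s' hs' u hu s hs u' hu' hrel).1
        have h1 := one_le_dp_self_of_ne_zero htt
        -- hence d k − d i ≥ 1 and the weight 2(d k − d i) ≥ 2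
        have hpos : 0 < d k - d i := by
          by_contra hle
          push Not at hle
          have : (α + γ) * (d k - d i) ≤ 0 :=
            mul_nonpos_of_nonneg_of_nonpos (by omega) hle
          omega
        omega
      · by_cases hjk : j = k
        · subst hjk
          -- pattern (i, j, j), i ≠ j :  (α−β)(d i − d j) = ‖u − u'‖²
          have hdec : s' - t = (s - t') + (u - u') := by
            have key : (s' - t) - ((s - t') + (u - u')) = 0 := by rw [← h0]; abel
            exact sub_eq_zero.1 key
          have horth : (s - t') ⬝ᵥ (u - u') = 0 := by
            rw [sub_dp_sub, hAC j s hs u hu, hAC j s hs u' hu', hBC j t' ht' u hu,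
              hBC j t' ht' u' hu']
            ring
          have hL : (s' - t) ⬝ᵥ (s' - t) = (xA + α * d i) + (xB - β * d i) := by
            rw [normsq_sub, hA i s' hs', hB i t ht, hAB i s' hs' t ht]; ring
          have hR : ((s - t') + (u - u')) ⬝ᵥ ((s - t') + (u - u')) =
              (xA + α * d j) + (xB - β * d j) + (u - u') ⬝ᵥ (u - u') := by
            rw [normsq_add, horth, normsq_sub s t', hA j s hs, hB j t' ht', hAB j s hs t' ht']; ring
          have heq : (α - β) * (d i - d j) = (u - u') ⬝ᵥ (u - u') := by
            have := hL; rw [hdec, hR] at this; linarith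
          have huu : u - u' ≠ 0 := by
            intro hz
            have huu' : u = u' := sub_eq_zero.1 hz
            -- relation becomes t − s' = t' − s with t ∈ B i, s' ∈ A i, t' ∈ B j, s ∈ A j
            have hrel : t - s' = t' - s := by
              have key : (t' - s) - (t - s') = 0 := by
                rw [← h0, huu', sub_self, add_zero]; abel
              exact (sub_eq_zero.1 key).symm
            exact hij (r2 i j s' hs' t ht s hs t' ht' hrel).1
          have h1 := one_le_dp_self_of_ne_zero huu
          have hpos : 0 < d j - d i := by
            by_contra hle
            push Not at hle
            have : (α - β) * (d i - d j) ≤ 0 :=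
              mul_nonpos_of_nonpos_of_nonneg (by omega) (by omega)
            omega
          omega
        · by_cases hik : i = k
          · subst hik
            -- pattern (i, j, i), i ≠ j :  (γ−β)(d j − d i) = ‖s − s'‖²
            have hdec : t' - u = (t - u') + (s - s') := by
              have key : (t' - u) - ((t - u') + (s - s')) = 0 := by rw [← h0]; abel
              exact sub_eq_zero.1 key
            have horth : (t - u') ⬝ᵥ (s - s') = 0 := by
              rw [sub_dp_sub, dotProduct_comm t s, hAB i s hs t ht, dotProduct_comm t s',
                hAB i s' hs' t ht, dotProduct_comm u' s, hAC i s hs u' hu', dotProduct_comm u' s',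
                hAC i s' hs' u' hu']
              ring
            have hL : (t' - u) ⬝ᵥ (t' - u) = (xB - β * d j) + (xC + γ * d j) := by
              rw [normsq_sub, hB j t' ht', hC j u hu, hBC j t' ht' u hu]; ring
            have hR : ((t - u') + (s - s')) ⬝ᵥ ((t - u') + (s - s')) =
                (xB - β * d i) + (xC + γ * d i) + (s - s') ⬝ᵥ (s - s') := by
              rw [normsq_add, horth, normsq_sub t u', hB i t ht, hC i u' hu', hBC i t ht u' hu']
              ring
            have heq : (γ - β) * (d j - d i) = (s - s') ⬝ᵥ (s - s') := by
              have := hL; rw [hdec, hR] at this; linarith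
            have hss : s - s' ≠ 0 := by
              intro hz
              have hss' : s = s' := sub_eq_zero.1 hz
              -- relation becomes t − u' = t' − u with t ∈ B i, u' ∈ C i, t' ∈ B j, u ∈ C j
              have hrel : t - u' = t' - u := by
                have key : (t' - u) - (t - u') = 0 := by
                  rw [← h0, hss', sub_self, zero_add]; abel
                exact (sub_eq_zero.1 key).symm
              exact hij (r3 i j t ht u' hu' t' ht' u hu hrel).1
            have h1 := one_le_dp_self_of_ne_zero hss
            have hpos : 0 < d i - d j := by
              by_contra hle
              push Not at hle
              have : (γ - β) * (d j - d i) ≤ 0 :=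
                mul_nonpos_of_nonpos_of_nonneg (by omega) (by omega)
              omega
            omega
          · -- all three labels distinct: excluded by (R4) when non-convex, weight ≥ 1 otherwise
            by_cases hconv : 2 * d k ≤ d i + d j
            · exact absurd h0 (r4 i j k hij hjk hik hconv s hs s' hs' t ht t' ht' u hu u' hu')
            · push Not at hconv
              omega

end Summit.MatrixMultiplication.MatrixMultiplication.Cruxes.ThinPackings.Drefute
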